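import Summits.CriticalPhenomena.CardyFormulaZ2.Theses.CardyBoundaryCoulombGas
import Literature.Probability.LatticeModels.RowStatePlanar
import Literature.Probability.Percolation.LatticeSymmetry
import Literature.Probability.Percolation.PlanarDuality
import Literature.Probability.Percolation.RussoFormula

/-!
# Counting formula at `p = 1/2` for events read through the column-by-column bond sequence

Helper file for the line `two-cluster-rate-is-stationary-gap` of the crux
`CardyBoundaryCoulombGas.StripClusterRates` (stmt-CriticalPhenomena-13878), stub D1
(`stub_oneClusterDictionary`); reusable by stub D3 (`stub_twoClusterDictionary`).

Reading a bond configuration `ω` of `ℤ²` through the crux rectangle `[0,m]×[0,n]` column by column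
gives the ADMISSIBLE SEQUENCE `seqOf ω m : Fin m → Finset S × Finset S`, `S = Finset.Icc (0:ℤ) n`,
`seqOf ω m t = (O_t, H_t)` with `O_t = {y : {(t,y),(t+1,y)} ∈ ω}` (horizontal lattice edges
between columns `t`, `t+1`) and `H_t = {y : y+1 ≤ n, {(t+1,y),(t+1,y+1)} ∈ ω} ⊆ hEdges S`
(vertical lattice edges of column `t+1`) — exactly the normalisation of `PercolationRowTransfer`
(`univ ×ˢ (hEdges S).powerset` per step). Written inline (no definitions) as
`fun t : Fin m => (univ.filter …, univ.filter …)`.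

* `d1_seqOf_eq_of_inter_eq`, `d1_determinedBy_seqOf_mem`, `d1_measurableSet_seqOf_mem` — the event `{ω | seqOf ω m ∈ A}` is
  determined by the finite set `E_m` of edges read (`m(n+1)` horizontal, `mn` vertical ones);
  `d1_readEdges_subset_edgeSet` — these are lattice edges; `d1_col0_notMem_readEdges` — none of
  them lies inside column `0`.
* `d1_bondPercolation_half_real_seqOf_mem` — **COUNTING FORMULA**: under critical bond percolation
  `P_{1/2}` the probability of `{ω | seqOf ω m ∈ A}` is the normalised count
  `#{seq admissible : seq ∈ A} / (2^{|S|} 2^{|hEdges S|})^m`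
  (cylinder decomposition `Russo.measureReal_eq_cylPoly`, every weight `= 1/2`, and the bijection
  `A ↦ seqOf A m` between `E_m.powerset` and the admissible sequences).

Sources: Bollobás–Riordan, *Percolation* (2006), Ch. 3 (`2^{-|E|}`-counting at `p = 1/2`);
Grimmett, *Percolation* (1999), §2.2 (cylinder events); folklore. -/

noncomputable section

namespace Summit.CriticalPhenomena.CardyFormulaZ2.Cruxes.StripClusterRates.TwoClusterRateIsStationaryGap

open Filter Topology MeasureTheory
open scoped BigOperators Classical
open Literature.Probability.Percolation Literature.Probability.LatticeModels

/-! ## The edges read by the sequence -/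

/-- Horizontal lattice edges between consecutive columns are determined by their labels. [folklore] -/
theorem d1_hor_eq_hor_iff {t t' y y' : ℤ} :
    s(![t, y], ![t + 1, y]) = s(![t', y'], ![t' + 1, y']) ↔ t = t' ∧ y = y' := by
  simp only [Sym2.eq_iff, Site.eq_iff_two, Matrix.cons_val_zero, Matrix.cons_val_one,
    Matrix.cons_val_fin_one]
  omega

/-- Vertical lattice edges are determined by their labels. [folklore] -/
theorem d1_ver_eq_ver_iff {t t' y y' : ℤ} :
    s(![t, y], ![t, y + 1]) = s(![t', y'], ![t', y' + 1]) ↔ t = t' ∧ y = y' := by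
  simp only [Sym2.eq_iff, Site.eq_iff_two, Matrix.cons_val_zero, Matrix.cons_val_one,
    Matrix.cons_val_fin_one]
  omega

/-- A horizontal lattice edge is not a vertical one. [folklore] -/
theorem d1_hor_ne_ver {t t' y y' : ℤ} : s(![t, y], ![t + 1, y]) ≠ s(![t', y'], ![t', y' + 1]) := by
  simp only [Ne, Sym2.eq_iff, Site.eq_iff_two, Matrix.cons_val_zero, Matrix.cons_val_one,
    Matrix.cons_val_fin_one]
  omega


/-! ## The finite set of edges read, locality, measurability -/

/-- The column-by-column reading of `ω` only depends on the edges read: the `m(n+1)` horizontal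
edges `{(t,y),(t+1,y)}` and the `mn` vertical edges `{(t+1,y),(t+1,y+1)}`, `t < m`. [folklore] -/
theorem d1_seqOf_eq_of_inter_eq (n m : ℕ) {ω ω' : BondConfig (Site 2)}
    (h : ω ∩ ↑((Finset.univ : Finset (Fin m × Finset.Icc (0 : ℤ) n)).image (fun p =>
          s(![((p.1 : ℕ) : ℤ), (p.2 : ℤ)], ![((p.1 : ℕ) : ℤ) + 1, (p.2 : ℤ)])) ∪
        ((Finset.univ : Finset (Fin m × Finset.Icc (0 : ℤ) n)).filter fun p =>
          (p.2 : ℤ) + 1 ∈ Finset.Icc (0 : ℤ) n).image (fun p =>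
          s(![((p.1 : ℕ) : ℤ) + 1, (p.2 : ℤ)], ![((p.1 : ℕ) : ℤ) + 1, (p.2 : ℤ) + 1]))) =
      ω' ∩ ↑((Finset.univ : Finset (Fin m × Finset.Icc (0 : ℤ) n)).image (fun p =>
          s(![((p.1 : ℕ) : ℤ), (p.2 : ℤ)], ![((p.1 : ℕ) : ℤ) + 1, (p.2 : ℤ)])) ∪
        ((Finset.univ : Finset (Fin m × Finset.Icc (0 : ℤ) n)).filter fun p =>
          (p.2 : ℤ) + 1 ∈ Finset.Icc (0 : ℤ) n).image (fun p =>
          s(![((p.1 : ℕ) : ℤ) + 1, (p.2 : ℤ)], ![((p.1 : ℕ) : ℤ) + 1, (p.2 : ℤ) + 1])))) :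
    (fun t : Fin m =>
      ((Finset.univ.filter fun y : Finset.Icc (0 : ℤ) n =>
          s(![((t : ℕ) : ℤ), (y : ℤ)], ![((t : ℕ) : ℤ) + 1, (y : ℤ)]) ∈ ω),
        (Finset.univ.filter fun y : Finset.Icc (0 : ℤ) n =>
          (y : ℤ) + 1 ∈ Finset.Icc (0 : ℤ) n ∧
            s(![((t : ℕ) : ℤ) + 1, (y : ℤ)], ![((t : ℕ) : ℤ) + 1, (y : ℤ) + 1]) ∈ ω))) =
    fun t : Fin m =>
      ((Finset.univ.filter fun y : Finset.Icc (0 : ℤ) n =>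
          s(![((t : ℕ) : ℤ), (y : ℤ)], ![((t : ℕ) : ℤ) + 1, (y : ℤ)]) ∈ ω'),
        (Finset.univ.filter fun y : Finset.Icc (0 : ℤ) n =>
          (y : ℤ) + 1 ∈ Finset.Icc (0 : ℤ) n ∧
            s(![((t : ℕ) : ℤ) + 1, (y : ℤ)], ![((t : ℕ) : ℤ) + 1, (y : ℤ) + 1]) ∈ ω')) := by
  have key : ∀ e, e ∈ (Finset.univ : Finset (Fin m × Finset.Icc (0 : ℤ) n)).image (fun p =>
          s(![((p.1 : ℕ) : ℤ), (p.2 : ℤ)], ![((p.1 : ℕ) : ℤ) + 1, (p.2 : ℤ)])) ∪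
        ((Finset.univ : Finset (Fin m × Finset.Icc (0 : ℤ) n)).filter fun p =>
          (p.2 : ℤ) + 1 ∈ Finset.Icc (0 : ℤ) n).image (fun p =>
          s(![((p.1 : ℕ) : ℤ) + 1, (p.2 : ℤ)], ![((p.1 : ℕ) : ℤ) + 1, (p.2 : ℤ) + 1])) →
      (e ∈ ω ↔ e ∈ ω') := by
    intro e he
    have h1 := Set.ext_iff.1 h e
    simp only [Set.mem_inter_iff, Finset.mem_coe] at h1
    exact ⟨fun h' => (h1.1 ⟨h', he⟩).1, fun h' => (h1.2 ⟨h', he⟩).1⟩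
  funext t
  ext y
  · simp only [Finset.mem_filter, Finset.mem_univ, true_and]
    refine key _ (Finset.mem_union_left _ (Finset.mem_image.2 ⟨(t, y), Finset.mem_univ _, rfl⟩))
  · simp only [Finset.mem_filter, Finset.mem_univ, true_and]
    refine and_congr_right fun hy => key _ (Finset.mem_union_right _ (Finset.mem_image.2 ?_))
    exact ⟨(t, y), Finset.mem_filter.2 ⟨Finset.mem_univ _, hy⟩, rfl⟩

/-- **Locality**: an event read through the bond sequence is determined by the finite set of edges
read. [folklore] -/
theorem d1_determinedBy_seqOf_mem (n m : ℕ)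
    (A : Set (Fin m → Finset (Finset.Icc (0 : ℤ) n) × Finset (Finset.Icc (0 : ℤ) n))) :
    DeterminedBy
      {ω : BondConfig (Site 2) | (fun t : Fin m =>
        ((Finset.univ.filter fun y : Finset.Icc (0 : ℤ) n =>
            s(![((t : ℕ) : ℤ), (y : ℤ)], ![((t : ℕ) : ℤ) + 1, (y : ℤ)]) ∈ ω),
          (Finset.univ.filter fun y : Finset.Icc (0 : ℤ) n =>
            (y : ℤ) + 1 ∈ Finset.Icc (0 : ℤ) n ∧
              s(![((t : ℕ) : ℤ) + 1, (y : ℤ)], ![((t : ℕ) : ℤ) + 1, (y : ℤ) + 1]) ∈ ω))) ∈ A}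
      ↑((Finset.univ : Finset (Fin m × Finset.Icc (0 : ℤ) n)).image (fun p =>
          s(![((p.1 : ℕ) : ℤ), (p.2 : ℤ)], ![((p.1 : ℕ) : ℤ) + 1, (p.2 : ℤ)])) ∪
        ((Finset.univ : Finset (Fin m × Finset.Icc (0 : ℤ) n)).filter fun p =>
          (p.2 : ℤ) + 1 ∈ Finset.Icc (0 : ℤ) n).image (fun p =>
          s(![((p.1 : ℕ) : ℤ) + 1, (p.2 : ℤ)], ![((p.1 : ℕ) : ℤ) + 1, (p.2 : ℤ) + 1]))) := by
  rw [determinedBy_iff]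
  intro ω ω' h
  simp only [Set.mem_setOf_eq]
  rw [d1_seqOf_eq_of_inter_eq n m h]

/-- Events read through the bond sequence are measurable. [folklore] -/
theorem d1_measurableSet_seqOf_mem (n m : ℕ)
    (A : Set (Fin m → Finset (Finset.Icc (0 : ℤ) n) × Finset (Finset.Icc (0 : ℤ) n))) :
    MeasurableSet
      {ω : BondConfig (Site 2) | (fun t : Fin m =>
        ((Finset.univ.filter fun y : Finset.Icc (0 : ℤ) n =>
            s(![((t : ℕ) : ℤ), (y : ℤ)], ![((t : ℕ) : ℤ) + 1, (y : ℤ)]) ∈ ω),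
          (Finset.univ.filter fun y : Finset.Icc (0 : ℤ) n =>
            (y : ℤ) + 1 ∈ Finset.Icc (0 : ℤ) n ∧
              s(![((t : ℕ) : ℤ) + 1, (y : ℤ)], ![((t : ℕ) : ℤ) + 1, (y : ℤ) + 1]) ∈ ω))) ∈ A} :=
  (d1_determinedBy_seqOf_mem n m A).measurableSet_of_finset

/-- The edges read are lattice edges. [folklore] -/
theorem d1_readEdges_subset_edgeSet (n m : ℕ) :
    (↑((Finset.univ : Finset (Fin m × Finset.Icc (0 : ℤ) n)).image (fun p =>
          s(![((p.1 : ℕ) : ℤ), (p.2 : ℤ)], ![((p.1 : ℕ) : ℤ) + 1, (p.2 : ℤ)])) ∪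
        ((Finset.univ : Finset (Fin m × Finset.Icc (0 : ℤ) n)).filter fun p =>
          (p.2 : ℤ) + 1 ∈ Finset.Icc (0 : ℤ) n).image (fun p =>
          s(![((p.1 : ℕ) : ℤ) + 1, (p.2 : ℤ)], ![((p.1 : ℕ) : ℤ) + 1, (p.2 : ℤ) + 1]))) :
        Set (Sym2 (Site 2))) ⊆ (zdGraph 2).edgeSet := by
  intro e he
  simp only [Finset.coe_union, Finset.coe_image, Finset.coe_univ, Set.image_univ, Finset.coe_filter,
    Set.mem_union, Set.mem_range, Set.mem_image, Set.mem_setOf_eq] at he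
  rcases he with ⟨p, rfl⟩ | ⟨p, -, rfl⟩
  · rw [SimpleGraph.mem_edgeSet, zdGraph_two_adj_iff]
    simp
  · rw [SimpleGraph.mem_edgeSet, zdGraph_two_adj_iff]
    simp

/-- No edge read lies inside column `0` (the column-`0` vertical edges, which randomise the start
of the free chain of stub D3, are independent of everything read). [folklore] -/
theorem d1_col0_notMem_readEdges (n m : ℕ) (j j' : ℤ) :
    s(![0, j], ![0, j']) ∉
      (Finset.univ : Finset (Fin m × Finset.Icc (0 : ℤ) n)).image (fun p =>
          s(![((p.1 : ℕ) : ℤ), (p.2 : ℤ)], ![((p.1 : ℕ) : ℤ) + 1, (p.2 : ℤ)])) ∪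
        ((Finset.univ : Finset (Fin m × Finset.Icc (0 : ℤ) n)).filter fun p =>
          (p.2 : ℤ) + 1 ∈ Finset.Icc (0 : ℤ) n).image (fun p =>
          s(![((p.1 : ℕ) : ℤ) + 1, (p.2 : ℤ)], ![((p.1 : ℕ) : ℤ) + 1, (p.2 : ℤ) + 1])) := by
  simp only [Finset.mem_union, Finset.mem_image, Finset.mem_filter, Finset.mem_univ, true_and,
    not_or, not_exists, not_and]
  constructor
  · intro p h
    simp only [Sym2.eq_iff, Site.eq_iff_two, Matrix.cons_val_zero, Matrix.cons_val_one,
      Matrix.cons_val_fin_one] at h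
    omega
  · intro p _ h
    simp only [Sym2.eq_iff, Site.eq_iff_two, Matrix.cons_val_zero, Matrix.cons_val_one,
      Matrix.cons_val_fin_one] at h
    omega

/-! ## The counting formula -/

/-- **Counting formula at `p = 1/2` for events read through the bond sequence.** For every set `A`
of sequences, the `P_{1/2}`-probability that the column-by-column reading
`seqOf ω m = (O_t, H_t)_{t<m}` of the configuration lies in `A` is the number of ADMISSIBLE
sequences (`seq t ∈ univ ×ˢ (hEdges S).powerset`) in `A` divided by `(2^{|S|} 2^{|hEdges S|})^m`:
the event is determined by the `m(2n+1)` lattice edges read, each open with probability `1/2`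
independently, and reading is a bijection between the subsets of these edges and the admissible
sequences. [folklore] -/
theorem d1_bondPercolation_half_real_seqOf_mem :
    ∀ (n m : ℕ) (A : Set (Fin m → Finset (Finset.Icc (0 : ℤ) n) × Finset (Finset.Icc (0 : ℤ) n))),
    (bondPercolation (zdGraph 2) half).real
        {ω | (fun t : Fin m =>
          ((Finset.univ.filter fun y : Finset.Icc (0 : ℤ) n =>
              s(![((t : ℕ) : ℤ), (y : ℤ)], ![((t : ℕ) : ℤ) + 1, (y : ℤ)]) ∈ ω),
            (Finset.univ.filter fun y : Finset.Icc (0 : ℤ) n =>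
              (y : ℤ) + 1 ∈ Finset.Icc (0 : ℤ) n ∧
                s(![((t : ℕ) : ℤ) + 1, (y : ℤ)], ![((t : ℕ) : ℤ) + 1, (y : ℤ) + 1]) ∈ ω))) ∈ A} =
      (((Fintype.piFinset fun _ : Fin m =>
            (Finset.univ : Finset (Finset (Finset.Icc (0 : ℤ) n))) ×ˢ
              (hEdges (Finset.Icc (0 : ℤ) n)).powerset).filter (· ∈ A)).card : ℝ) /
        ((2 : ℝ) ^ (Finset.Icc (0 : ℤ) n).card * 2 ^ (hEdges (Finset.Icc (0 : ℤ) n)).card) ^ m := by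
  intro n m A
  -- the two families of edges read, and the reading map `Θ`
  set hor : Fin m × Finset.Icc (0 : ℤ) n → Sym2 (Site 2) :=
    fun p => s(![((p.1 : ℕ) : ℤ), (p.2 : ℤ)], ![((p.1 : ℕ) : ℤ) + 1, (p.2 : ℤ)]) with hhor
  set ver : Fin m × Finset.Icc (0 : ℤ) n → Sym2 (Site 2) :=
    fun p => s(![((p.1 : ℕ) : ℤ) + 1, (p.2 : ℤ)], ![((p.1 : ℕ) : ℤ) + 1, (p.2 : ℤ) + 1]) with hver
  set Θ : Set (Sym2 (Site 2)) →
      (Fin m → Finset (Finset.Icc (0 : ℤ) n) × Finset (Finset.Icc (0 : ℤ) n)) :=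
    fun ω t => ((Finset.univ.filter fun y => hor (t, y) ∈ ω),
      (Finset.univ.filter fun y => (y : ℤ) + 1 ∈ Finset.Icc (0 : ℤ) n ∧ ver (t, y) ∈ ω)) with hΘ
  set W := Fintype.piFinset fun _ : Fin m =>
    (Finset.univ : Finset (Finset (Finset.Icc (0 : ℤ) n))) ×ˢ (hEdges (Finset.Icc (0 : ℤ) n)).powerset
    with hW
  show (bondPercolation (zdGraph 2) half).real {ω | Θ ω ∈ A} = ((W.filter (· ∈ A)).card : ℝ) / _
  set E : Finset (Sym2 (Site 2)) := Finset.univ.image hor ∪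
    (Finset.univ.filter fun p : Fin m × Finset.Icc (0 : ℤ) n =>
      (p.2 : ℤ) + 1 ∈ Finset.Icc (0 : ℤ) n).image ver with hE
  set B : Set (Set (Sym2 (Site 2))) := {ω | Θ ω ∈ A} with hB
  -- injectivity of the labels
  have hor_inj : ∀ {p p' : Fin m × Finset.Icc (0 : ℤ) n}, hor p = hor p' ↔ p = p' := by
    refine fun {p p'} => ⟨fun h => ?_, fun h => by rw [h]⟩
    have h' := d1_hor_eq_hor_iff.1 h
    exact Prod.ext (Fin.ext (by omega)) (Subtype.ext h'.2)
  have ver_inj : ∀ {p p' : Fin m × Finset.Icc (0 : ℤ) n}, ver p = ver p' ↔ p = p' := by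
    refine fun {p p'} => ⟨fun h => ?_, fun h => by rw [h]⟩
    have h' := d1_ver_eq_ver_iff.1 h
    exact Prod.ext (Fin.ext (by omega)) (Subtype.ext h'.2)
  have hor_ne_ver : ∀ {p p' : Fin m × Finset.Icc (0 : ℤ) n}, hor p ≠ ver p' := d1_hor_ne_ver
  -- membership in `E`
  have mem_E : ∀ {e : Sym2 (Site 2)}, e ∈ E ↔ (∃ p, e = hor p) ∨
      ∃ p : Fin m × Finset.Icc (0 : ℤ) n, (p.2 : ℤ) + 1 ∈ Finset.Icc (0 : ℤ) n ∧ e = ver p := by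
    intro e
    simp only [hE, Finset.mem_union, Finset.mem_image, Finset.mem_univ, true_and,
      Finset.mem_filter]
    constructor
    · rintro (⟨p, rfl⟩ | ⟨p, hp, rfl⟩)
      · exact Or.inl ⟨p, rfl⟩
      · exact Or.inr ⟨p, hp, rfl⟩
    · rintro (⟨p, rfl⟩ | ⟨p, hp, rfl⟩)
      · exact Or.inl ⟨p, rfl⟩
      · exact Or.inr ⟨p, hp, rfl⟩
  have hor_mem_E : ∀ p, hor p ∈ E := fun p => mem_E.2 (Or.inl ⟨p, rfl⟩)
  have ver_mem_E : ∀ p : Fin m × Finset.Icc (0 : ℤ) n, (p.2 : ℤ) + 1 ∈ Finset.Icc (0 : ℤ) n →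
      ver p ∈ E := fun p hp => mem_E.2 (Or.inr ⟨p, hp, rfl⟩)
  -- `E` consists of lattice edges
  have hEsub : (E : Set (Sym2 (Site 2))) ⊆ (zdGraph 2).edgeSet := by
    intro e he
    rcases mem_E.1 (Finset.mem_coe.1 he) with ⟨p, rfl⟩ | ⟨p, -, rfl⟩
    · rw [hhor, SimpleGraph.mem_edgeSet, zdGraph_two_adj_iff]
      simp
    · rw [hver, SimpleGraph.mem_edgeSet, zdGraph_two_adj_iff]
      simp
  -- reading only depends on the edges of `E`
  have hΘE : ∀ ω : Set (Sym2 (Site 2)), Θ (ω ∩ ↑E) = Θ ω := by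
    intro ω
    funext t
    simp only [hΘ]
    ext y
    · simp only [Finset.mem_filter, Finset.mem_univ, true_and, Set.mem_inter_iff, Finset.mem_coe]
      exact ⟨fun h => h.1, fun h => ⟨h, hor_mem_E _⟩⟩
    · simp only [Finset.mem_filter, Finset.mem_univ, true_and, Set.mem_inter_iff, Finset.mem_coe]
      exact ⟨fun h => ⟨h.1, h.2.1⟩, fun h => ⟨h.1, h.2, ver_mem_E (t, y) h.1⟩⟩
  have hdet : DeterminedBy B ↑E := by
    rw [determinedBy_iff]
    intro ω ω' h
    simp only [hB, Set.mem_setOf_eq]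
    rw [← hΘE ω, ← hΘE ω', h]
  -- admissibility of every reading
  have hΘmem : ∀ ω, Θ ω ∈ W := by
    intro ω
    rw [hW, Fintype.mem_piFinset]
    intro t
    simp only [hΘ, Finset.mem_product, Finset.mem_univ, true_and, Finset.mem_powerset]
    intro y hy
    exact (mem_hEdges y).2 (Finset.mem_filter.1 hy).2.1
  -- the inverse of reading: the edge set of a sequence
  set Ψ : (Fin m → Finset (Finset.Icc (0 : ℤ) n) × Finset (Finset.Icc (0 : ℤ) n)) →
      Finset (Sym2 (Site 2)) := fun seq =>
    (Finset.univ.filter fun p : Fin m × Finset.Icc (0 : ℤ) n => p.2 ∈ (seq p.1).1).image hor ∪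
      (Finset.univ.filter fun p : Fin m × Finset.Icc (0 : ℤ) n => p.2 ∈ (seq p.1).2).image ver
    with hΨ
  have mem_Ψ_hor : ∀ seq (p : Fin m × Finset.Icc (0 : ℤ) n), hor p ∈ Ψ seq ↔ p.2 ∈ (seq p.1).1 := by
    intro seq p
    simp only [hΨ, Finset.mem_union, Finset.mem_image, Finset.mem_filter, Finset.mem_univ, true_and]
    constructor
    · rintro (⟨p', hp', h⟩ | ⟨p', -, h⟩)
      · rwa [← hor_inj.1 h]
      · exact absurd h.symm hor_ne_ver
    · exact fun h => Or.inl ⟨p, h, rfl⟩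
  have mem_Ψ_ver : ∀ seq (p : Fin m × Finset.Icc (0 : ℤ) n), ver p ∈ Ψ seq ↔ p.2 ∈ (seq p.1).2 := by
    intro seq p
    simp only [hΨ, Finset.mem_union, Finset.mem_image, Finset.mem_filter, Finset.mem_univ, true_and]
    constructor
    · rintro (⟨p', -, h⟩ | ⟨p', hp', h⟩)
      · exact absurd h hor_ne_ver
      · rwa [← ver_inj.1 h]
    · exact fun h => Or.inr ⟨p, h, rfl⟩
  have hΨsub : ∀ seq ∈ W, Ψ seq ⊆ E := by
    intro seq hseq e he
    rw [hW, Fintype.mem_piFinset] at hseq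
    simp only [hΨ, Finset.mem_union, Finset.mem_image, Finset.mem_filter, Finset.mem_univ,
      true_and] at he
    rcases he with ⟨p, -, rfl⟩ | ⟨p, hp, rfl⟩
    · exact hor_mem_E p
    · refine ver_mem_E p ((mem_hEdges p.2).1 ?_)
      exact Finset.mem_powerset.1 (Finset.mem_product.1 (hseq p.1)).2 hp
  have hΘΨ : ∀ seq ∈ W, Θ ↑(Ψ seq) = seq := by
    intro seq hseq
    rw [hW, Fintype.mem_piFinset] at hseq
    funext t
    simp only [hΘ]
    ext y
    · simp only [Finset.mem_filter, Finset.mem_univ, true_and, Finset.mem_coe]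
      exact mem_Ψ_hor seq (t, y)
    · simp only [Finset.mem_filter, Finset.mem_univ, true_and, Finset.mem_coe]
      rw [mem_Ψ_ver seq (t, y)]
      refine ⟨fun h => h.2, fun h => ⟨(mem_hEdges y).1 ?_, h⟩⟩
      exact Finset.mem_powerset.1 (Finset.mem_product.1 (hseq t)).2 h
  have hΨΘ : ∀ T : Finset (Sym2 (Site 2)), T ⊆ E → Ψ (Θ ↑T) = T := by
    intro T hT
    ext e
    constructor
    · intro he
      simp only [hΨ, Finset.mem_union, Finset.mem_image, Finset.mem_filter, Finset.mem_univ,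
        true_and] at he
      rcases he with ⟨p, hp, rfl⟩ | ⟨p, hp, rfl⟩
      · simp only [hΘ, Finset.mem_filter, Finset.mem_univ, true_and, Finset.mem_coe] at hp
        exact hp
      · simp only [hΘ, Finset.mem_filter, Finset.mem_univ, true_and, Finset.mem_coe] at hp
        exact hp.2
    · intro he
      rcases mem_E.1 (hT he) with ⟨p, rfl⟩ | ⟨p, hp, rfl⟩
      · rw [mem_Ψ_hor]
        simp only [hΘ, Finset.mem_filter, Finset.mem_univ, true_and, Finset.mem_coe]
        exact he
      · rw [mem_Ψ_ver]
        simp only [hΘ, Finset.mem_filter, Finset.mem_univ, true_and, Finset.mem_coe]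
        exact ⟨hp, he⟩
  -- the two counts
  have hcardA : (E.powerset.filter fun T : Finset (Sym2 (Site 2)) =>
      (↑T : Set (Sym2 (Site 2))) ∈ B).card = (W.filter (· ∈ A)).card := by
    refine Finset.card_nbij (fun T => Θ ↑T) ?_ ?_ ?_
    · intro T hT
      rw [Finset.coe_filter, Set.mem_setOf_eq] at hT ⊢
      exact ⟨hΘmem _, hT.2⟩
    · intro T₁ h₁ T₂ h₂ heq
      rw [Finset.coe_filter, Set.mem_setOf_eq, Finset.mem_powerset] at h₁ h₂
      simp only at heq
      rw [← hΨΘ T₁ h₁.1, ← hΨΘ T₂ h₂.1, heq]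
    · intro seq hseq
      rw [Finset.coe_filter, Set.mem_setOf_eq] at hseq
      refine ⟨Ψ seq, ?_, hΘΨ seq hseq.1⟩
      rw [Finset.coe_filter, Set.mem_setOf_eq, Finset.mem_powerset]
      refine ⟨hΨsub seq hseq.1, ?_⟩
      show Θ ↑(Ψ seq) ∈ A
      rw [hΘΨ seq hseq.1]
      exact hseq.2
  have hcardW : E.powerset.card = W.card := by
    refine Finset.card_nbij (fun T => Θ ↑T) (fun T _ => hΘmem _) ?_ ?_
    · intro T₁ h₁ T₂ h₂ heq
      rw [Finset.coe_powerset] at h₁ h₂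
      simp only at heq
      rw [← hΨΘ T₁ h₁, ← hΨΘ T₂ h₂, heq]
    · intro seq hseq
      exact ⟨Ψ seq, Finset.mem_powerset.2 (hΨsub seq hseq), hΘΨ seq hseq⟩
  -- the total weight is `2^{|E|}`
  have htot : ((2 : ℝ) ^ (Finset.Icc (0 : ℤ) n).card * 2 ^ (hEdges (Finset.Icc (0 : ℤ) n)).card) ^ m =
      (2 : ℝ) ^ E.card := by
    have h1 : W.card = ((Finset.univ : Finset (Finset (Finset.Icc (0 : ℤ) n))) ×ˢ
        (hEdges (Finset.Icc (0 : ℤ) n)).powerset).card ^ m := by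
      rw [hW, Fintype.card_piFinset, Finset.prod_const, Finset.card_univ, Fintype.card_fin]
    rw [← card_univ_product_powerset, ← Nat.cast_pow, ← h1, ← hcardW, Finset.card_powerset,
      Nat.cast_pow, Nat.cast_ofNat]
  -- the cylinder decomposition
  have hP : (bondPercolation (zdGraph 2) half).real B =
      ∑ T ∈ E.powerset, if (↑T : Set (Sym2 (Site 2))) ∈ B then
        ∏ i ∈ E, Russo.weight (zdGraph 2).edgeSet ↑T i (1 / 2 : ℝ) else 0 := by
    have := Russo.measureReal_eq_cylPoly hdet (zdGraph 2).edgeSet half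
    rw [coe_half] at this; exact this
  have hw : ∀ T ∈ E.powerset,
      ∏ i ∈ E, Russo.weight (zdGraph 2).edgeSet (↑T : Set (Sym2 (Site 2))) i (1 / 2 : ℝ) =
        (1 / 2 : ℝ) ^ E.card := by
    intro T _
    rw [← Finset.prod_const]
    refine Finset.prod_congr rfl fun i hi => ?_
    have hiu : i ∈ (zdGraph 2).edgeSet := hEsub (Finset.mem_coe.2 hi)
    unfold Russo.weight
    by_cases hiT : i ∈ (↑T : Set (Sym2 (Site 2)))
    · rw [if_pos hiT, if_pos hiu]
    · rw [if_neg hiT, if_pos hiu]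
      norm_num
  rw [hP, ← Finset.sum_filter, Finset.sum_congr rfl fun T hT => hw T (Finset.mem_filter.1 hT).1,
    Finset.sum_const, nsmul_eq_mul, hcardA, htot, one_div, inv_pow, div_eq_mul_inv]

end Summit.CriticalPhenomena.CardyFormulaZ2.Cruxes.StripClusterRates.TwoClusterRateIsStationaryGap
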